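import Literature.Barriers.ValiantsHypothesis.NotViaSaturationsChowNormal
import Literature.Barriers.ValiantsHypothesis.NotViaSaturationsThm3
import HarnessLib

/-!
# Not via saturations — BHI Prop. 1 (cone part) for the Chow variety, proved

Sibling proof file of `NotViaSaturationsChowNormal.lean`, which vendors from P. Bürgisser,
J. Hüttenhain, C. Ikenmeyer, *Permanent versus determinant: not via saturations*, Proc. AMS 145
(2017) = arXiv:1501.05528, the named fact `BHI2017_prop1_cone`: "According to Proposition 1, the
semigroups `S(Chow_n)` and `S(V^n // H_n)` generate the same rational cone" (§3, proof of Prop. 2;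
Prop. 1, §2: "`Sat(S(Z̃)) = Sat(S(Z))` … it suffices to prove that `C_ℚ(S(Z)) = C_ℚ(S(Z̃))`", with
Lemma 3 (Brion: `ψ_n : V^n // H_n → Chow_n` is the normalisation) and Lemma 4
(`S(V^n // H_n) = {λ | n ∣ |λ|, V(λ) occurs in Sym^n Sym^{|λ|/n} ℂ^n}` = `normChowWeights n`)), in
the form `χ ∈ C_ℚ(S(Chow_n)) ↔ ∃ k > 0, k·χ ∈ normChowWeights n`. This file DISCHARGES it
(`BHI2017_prop1_cone_holds`).

**Proof.** Both cones are the cone of polynomial weights of `GL_n`: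

* `⊇` (`mem_ratCone_of_nsmul_mem_normChowWeights`): a weight occurring in `k[Sym^e k^n]`
  (`symSymOcc`) is the dual of a polynomial weight (`isPolynomial_dual_of_hasHighestWeight_coordRep`:
  a nonzero highest-weight vector does not vanish at some form `f`, so its weight occurs in the
  coordinate ring of the orbit closure of `f`, where the tree's weight analysis
  `isDominant_of_hasHighestWeight_orbitCoordRep`, `nonpos_and_exists_size_eq_of_hasHighestWeight_orbitCoordRep`
  applies), and every polynomial weight has a positive multiple in `S(Chow_n)`
  (`exists_nsmul_mem_chowOccWeights` of `NotViaSaturationsThm3.lean`: the cone generators realised in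
  `𝒪(V^n // H_n)` and pushed into `𝒪(Chow_n)` by BRION'S THEOREM `exists_symBalanced_subset_range` —
  this is where the normalisation enters, replacing Prop. 1's minimal-polynomial argument).
* `⊆` (`exists_nsmul_mem_normChowWeights_of_mem_ratCone`): a weight `χ ≠ 0` with a positive multiple
  in `S(Chow_n)` is polynomial, so `2n·χ` is REALISED (`isRealized_conePsi`, `ChowHighestWeight.lean`)
  by a nonzero highest-weight vector of `formsRep` in `𝒪(V^n // H_n)_δ = Sym^n Sym^δ V^*`
  (`symBalanced n δ`, balanced form-symmetric polynomials on `Mat_n`), `δ = coneDeg χ > 0`. The new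
  ingredient of this file is the **transfer** of such vectors to the tree's model `k[Sym^δ k^n]`
  (`coordRep`, in which `normChowWeights`/`symSymOcc` are phrased):
  `exists_mem_highestWeightSpace_coordRep_of_isRealized` — a realised weight `ψ` has a nonzero
  highest-weight vector of weight `ψ` among the forms of degree `n` on `Sym^δ k^n`, whence
  `ψ^* ∈ normChowWeights n` (`dual_mem_normChowWeights_of_isRealized`, the size `|ψ| = -nδ` being
  read off a monomial, `size_eq_of_mem_highestWeightSpace_coordRep`).

**The transfer map** (written out in place, no auxiliary definitions). `T : k[Sym^δ k^n] → k[Mat_n]`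
is the pullback along the power-sum map `(ℓ_0,…,ℓ_{n-1}) ↦ ℓ_0^δ + ⋯ + ℓ_{n-1}^δ` (the tree's
generic orbit map `genericOrbitMap (∑ X_i^δ) δ` of the Fermat form, `genericOrbitMap_powerSum_X`)
followed by the projection `weightedHomogeneousComponent (colWeight n) (δ,…,δ)` onto column
multidegree `(δ,…,δ)`; on a form of degree `n` it is the full polarisation evaluated at
`(ℓ_0^δ,…,ℓ_{n-1}^δ)`. It is `GL_n`-equivariant (`transfer_coordSubst`, from
`genericOrbitMap_coordSubst`: EVERY generic orbit map is equivariant `coordRep → formsRep`, by the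
value computation of `chowPullback_coordSubst`, and `weightedHomogeneousComponent_formsRep`: the
action preserves column multidegrees), and on a product of column coordinates `∏_j X_{α_j}` it gives
`(∏_j multinomial(α_j)) · ∑_{τ ∈ S_n} τ · ∏_j x_{·,j}^{α_j}` (`transfer_prod_X`: expanding
`∏_j ∑_i multinomial(α_j) x_{·,i}^{α_j}` over maps `t : [n] → [n]`, exactly the bijective `t` give
balanced terms), so that in characteristic zero `symBalanced n δ ⊆ T(k[Sym^δ k^n]_n)`
(`symBalanced_le_map`, via `G = (n!)⁻¹ ∑_τ τ·G`). Highest-weight vectors of the image then lift to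
the degree-`n` piece by complete reducibility (`map_highestWeightSpace_eq_of_surjective`,
`isSemisimpleRepresentation_coordRep`), as in `exists_mem_highestWeightSpace_chowPullback_eq`.

What is NOT here: the group part `BHI2017_prop1_group` (for `n ≤ 2` it needs the direct embedding
`𝒪(Chow_n) ↪ 𝒪(V^n // H_n)` at the level of highest-weight vectors, not the cone), the plethysm
facts `BCI2011_evenPlethysm`, `BHI2017_lemma6` (not needed: Theorem 3 is `BHI2017_thm3_holds`).

## References

* [BurgisserHuttenhainIkenmeyer2017] BHI, Proc. AMS 145 (2017) = arXiv:1501.05528: §2 Prop. 1 and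
  its proof; §3 Lemma 3, Lemma 4 and (5), proof of Prop. 2 ("the semigroups `S(Chow_n)` and
  `S(V^n // H_n)` generate the same rational cone").
* [BurgisserEtAl2011] BLMW, SIAM J. Comput. 40 (2011), §4.4, (5.2.2) (weights of coordinate rings
  are duals of partitions; a weight pins the degree).
* M. Brion, Manuscripta Math. 80 (1993) 347–371 (finiteness of `ψ_n`), as used through
  `NotViaSaturationsThm3.lean`.
-/

noncomputable section

open MvPolynomial

namespace Literature.Barriers.ValiantsHypothesis

open Literature.NumberTheory.DiophantineGeometry Literature.Computability.AlgebraicComplexity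
  Literature.Computability.Complexity

variable {k : Type*} [Field k] {n : ℕ}

/-! ### Generic orbit maps are `GL_n`-equivariant into `k[Mat_n]` -/

/-- Composing two linear substitutions. [folklore] -/
theorem linSubst_linSubst {σ : Type*} [Fintype σ] (A B : Matrix σ σ k) (f : MvPolynomial σ k) :
    linSubst σ k A (linSubst σ k B f) = linSubst σ k (A * B) f := by
  rw [linSubst_mul]
  rfl

/-- Values of a generic orbit map at a point `w` of matrix space: `F` at the coefficient vector of
`A_w · f`, `A_w` the matrix with entries `w`. [folklore] -/
theorem eval_genericOrbitMap_of (f : MvPolynomial (Fin n) k) (m : ℕ)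
    (F : MvPolynomial (DegIdx (Fin n) m) k) (w : Fin n × Fin n → k) :
    eval w (genericOrbitMap f m F) =
      aeval (formCoeff m (linSubst (Fin n) k (Matrix.of fun i j => w (i, j)) f)) F := by
  have h := eval_genericOrbitMap f m F (Matrix.of fun i j => w (i, j))
  have hw : (fun ij : Fin n × Fin n => (Matrix.of fun i j => w (i, j)) ij.1 ij.2) = w := by
    funext ij
    rw [Matrix.of_apply]
  rw [hw] at h
  exact h

/-- **Every generic orbit map `F ↦ (A ↦ F(A · f))` is `GL_n`-equivariant** from `k[Sym^m k^n]`
(`coordRep`) to `k[Mat_n]` (`formsRep`), over an infinite field (checked on values; the case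
`f = X_0⋯X_{n-1}` is `chowPullback_coordSubst`). [folklore] -/
theorem genericOrbitMap_coordSubst [Infinite k] (f : MvPolynomial (Fin n) k) (m : ℕ)
    (g : GL (Fin n) k) (F : MvPolynomial (DegIdx (Fin n) m) k) :
    genericOrbitMap f m (coordSubst m g F) = formsRep n g (genericOrbitMap f m F) := by
  apply MvPolynomial.funext
  intro w
  rw [eval_genericOrbitMap_of, aeval_formCoeff_coordSubst, eval_formsRep, eval_genericOrbitMap_of,
    linSubstRep_apply, linSubst_linSubst]
  congr 3

/-! ### The power-sum pullback `F ↦ F(ℓ_0^δ + ⋯ + ℓ_{n-1}^δ)` -/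

/-- **The power-sum pullback** of polynomial functions on `Sym^δ k^n` along
`(ℓ_0, …, ℓ_{n-1}) ↦ ℓ_0^δ + ⋯ + ℓ_{n-1}^δ` from `n`-tuples of linear forms is the generic orbit map
of the Fermat form `∑_i X_i^δ`; on a coordinate function it is the sum over the forms of the
corresponding coefficient of `ℓ_i^δ`. [folklore] -/
theorem genericOrbitMap_powerSum_X {δ : ℕ} (e : DegIdx (Fin n) δ) :
    genericOrbitMap (∑ i : Fin n, (X i : MvPolynomial (Fin n) k) ^ δ) δ (X e) =
      ∑ i : Fin n, coeff e.1 (genericLinForm (k := k) n i ^ δ) := by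
  unfold genericOrbitMap
  rw [aeval_X, map_sum, map_sum, coeff_sum]
  refine Finset.sum_congr rfl fun i _ => ?_
  rw [map_pow, map_pow, map_X, linSubst_X, genericLinForm]
  congr 2
  refine Finset.sum_congr rfl fun j _ => ?_
  rw [Matrix.mvPolynomialX_apply, smul_eq_C_mul]

/-- Values of the exponent `α ∈ ℕ^n` placed in column `i` of `Mat_n`. [folklore] -/
theorem mapDomain_col_apply (i : Fin n) (α : Fin n →₀ ℕ) (r i' : Fin n) :
    Finsupp.mapDomain (fun r : Fin n => (r, i)) α (r, i') = if i' = i then α r else 0 := by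
  by_cases h : i' = i
  · subst h
    rw [if_pos rfl, Finsupp.mapDomain_apply (fun a b hab => (Prod.mk.inj hab).1)]
  · rw [if_neg h, Finsupp.mapDomain_notin_range]
    rintro ⟨r', hr'⟩
    exact h (Prod.mk.inj hr').2.symm

/-- **The coefficients of a power of a generic linear form** (multinomial theorem): for `|α| = δ`,
`coeff_α (ℓ_i^δ) = multinomial(α) · ∏_r X_{(r,i)}^{α_r}`. [folklore] -/
theorem coeff_genericLinForm_pow {δ : ℕ} (i : Fin n) (α : Fin n →₀ ℕ) (hα : α.degree = δ) :
    coeff α (genericLinForm (k := k) n i ^ δ) =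
      monomial (Finsupp.mapDomain (fun r : Fin n => (r, i)) α) ((α.multinomial : ℕ) : k) := by
  have hform : genericLinForm (k := k) n i =
      ∑ r : Fin n, (X (r, i) : MvPolynomial (Fin n × Fin n) k) • X r := by
    simp only [genericLinForm, smul_eq_C_mul]
  have hsum : (α.sum fun _ m => m) = δ := by
    rw [← hα]
    rfl
  rw [hform, coeff_linearCombination_X_pow_of_fintype, if_pos hsum, monomial_eq,
    Finsupp.prod_mapDomain_index (fun _ => pow_zero _) (fun _ _ _ => pow_add _ _ _), map_natCast]

/-! ### The balanced projection commutes with `GL_n` -/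

/-- The action of `GL_n` on a monomial of `k[Mat_n]` is weighted-homogeneous of the monomial's
column multidegree (each variable goes to a linear form in its own column). [folklore] -/
theorem isWeightedHomogeneous_formsRep_monomial (g : GL (Fin n) k) (s : Fin n × Fin n →₀ ℕ) (c : k) :
    IsWeightedHomogeneous (colWeight n) (formsRep n g (monomial s c))
      (Finsupp.weight (colWeight n) s) := by
  rw [← mul_one c, ← smul_eq_mul, ← smul_monomial, map_smul, smul_eq_C_mul]
  refine IsWeightedHomogeneous.C_mul ?_ _
  rw [formsRep_apply, linSubst, aeval_monomial, map_one, one_mul]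
  have h := IsWeightedHomogeneous.prod s.support
    (fun v => (∑ u, (((formsBlockGL n g : GL (Fin n × Fin n) k) : Matrix _ _ k) u v • X u :
      MvPolynomial (Fin n × Fin n) k)) ^ s v)
    (fun v => s v • colWeight n v) (w := colWeight n) fun v _ => by
      have hX := isWeightedHomogeneous_formsRep_X (k := k) n g v
      rw [formsRep_apply, linSubst_X] at hX
      exact hX.pow _
  rw [Finsupp.prod]
  have hsum : ∑ v ∈ s.support, s v • colWeight n v = Finsupp.weight (colWeight n) s := by
    rw [Finsupp.weight_apply, Finsupp.sum]
  rw [hsum] at h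
  exact h

/-- **The projection onto a column multidegree commutes with the action of `GL_n`** on
`k[Mat_n]` (the action preserves column multidegrees). [folklore] -/
theorem weightedHomogeneousComponent_formsRep (g : GL (Fin n) k) (w : Fin n → ℕ)
    (G : MvPolynomial (Fin n × Fin n) k) :
    weightedHomogeneousComponent (colWeight n) w (formsRep n g G) =
      formsRep n g (weightedHomogeneousComponent (colWeight n) w G) := by
  classical
  conv_lhs => rw [as_sum G]
  conv_rhs => rw [as_sum G]
  simp only [map_sum]
  refine Finset.sum_congr rfl fun s _ => ?_
  rw [weightedHomogeneousComponent_of_mem (isWeightedHomogeneous_formsRep_monomial g s _),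
    weightedHomogeneousComponent_of_mem (isWeightedHomogeneous_monomial (colWeight n) s _ rfl)]
  split_ifs with h
  · rfl
  · rw [map_zero]

/-- **The transfer map `T = balancedPart_δ ∘ (power-sum pullback)` is `GL_n`-equivariant**
(`T : k[Sym^δ k^n] → k[Mat_n]`; on a form of degree `n` it is the full polarisation evaluated at
`(ℓ_0^δ, …, ℓ_{n-1}^δ)`, an element of `Sym^δ V^* ⊗ ⋯ ⊗ Sym^δ V^*` symmetric in the forms, i.e. of
`Sym^n Sym^δ V^* = 𝒪(V^n // H_n)_δ`). [folklore] -/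
theorem transfer_coordSubst [Infinite k] {δ : ℕ} (g : GL (Fin n) k)
    (F : MvPolynomial (DegIdx (Fin n) δ) k) :
    weightedHomogeneousComponent (colWeight n) (fun _ : Fin n => δ)
        (genericOrbitMap (∑ i : Fin n, (X i : MvPolynomial (Fin n) k) ^ δ) δ (coordSubst δ g F)) =
      formsRep n g (weightedHomogeneousComponent (colWeight n) (fun _ : Fin n => δ)
        (genericOrbitMap (∑ i : Fin n, (X i : MvPolynomial (Fin n) k) ^ δ) δ F)) := by
  rw [genericOrbitMap_coordSubst, weightedHomogeneousComponent_formsRep]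

/-! ### The transfer of a product of column coordinates -/

/-- The column multidegree of the exponent with columns `α_j` placed in columns `t j`: column `i'`
has degree `δ · #{j | t j = i'}` when every `α_j` has degree `δ`. [folklore] -/
theorem weight_sum_mapDomain_col {δ : ℕ} (α : Fin n → (Fin n →₀ ℕ)) (hα : ∀ j, (α j).degree = δ)
    (t : Fin n → Fin n) (i' : Fin n) :
    Finsupp.weight (colWeight n) (∑ j : Fin n, Finsupp.mapDomain (fun r : Fin n => (r, t j)) (α j)) i' =
      δ * (Finset.univ.filter fun j => t j = i').card := by
  classical
  rw [weight_colWeight_apply]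
  simp only [Finsupp.coe_finsetSum, Finset.sum_apply, mapDomain_col_apply]
  rw [Finset.sum_comm]
  have hcol : ∀ j : Fin n, (∑ r : Fin n, if i' = t j then α j r else 0) = if t j = i' then δ else 0 := by
    intro j
    by_cases h : t j = i'
    · rw [if_pos h]
      simp only [if_pos h.symm]
      rw [← Finsupp.degree_eq_sum, hα j]
    · rw [if_neg h]
      exact Finset.sum_eq_zero fun r _ => if_neg (Ne.symm h)
  simp only [hcol]
  rw [← Finset.sum_filter, Finset.sum_const, smul_eq_mul, mul_comm]

/-- For `δ > 0`, the exponent with columns `α_j` (of degree `δ`) placed in columns `t j` is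
balanced of degree `δ` iff `t` is a bijection. [folklore] -/
theorem weight_sum_mapDomain_col_eq_iff {δ : ℕ} (hδ : 0 < δ) (α : Fin n → (Fin n →₀ ℕ))
    (hα : ∀ j, (α j).degree = δ) (t : Fin n → Fin n) :
    (Finsupp.weight (colWeight n) (∑ j : Fin n, Finsupp.mapDomain (fun r : Fin n => (r, t j)) (α j)) =
        fun _ => δ) ↔ Function.Bijective t := by
  classical
  constructor
  · intro h
    have hcard : ∀ i', (Finset.univ.filter fun j => t j = i').card = 1 := by
      intro i'
      have hi := congr_fun h i'
      rw [weight_sum_mapDomain_col α hα t i'] at hi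
      have : δ * (Finset.univ.filter fun j => t j = i').card = δ * 1 := by rw [mul_one]; exact hi
      exact Nat.eq_of_mul_eq_mul_left hδ this
    have hsurj : Function.Surjective t := fun i' => by
      obtain ⟨j, hj⟩ := Finset.card_eq_one.mp (hcard i')
      have hmem : j ∈ Finset.univ.filter fun j => t j = i' := by
        rw [hj]
        exact Finset.mem_singleton_self j
      exact ⟨j, (Finset.mem_filter.mp hmem).2⟩
    exact ⟨Finite.injective_iff_surjective.mpr hsurj, hsurj⟩
  · intro ht
    funext i'
    rw [weight_sum_mapDomain_col α hα t i']
    have hcard : (Finset.univ.filter fun j => t j = i').card = 1 := by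
      rw [Finset.card_eq_one]
      refine ⟨(Equiv.ofBijective t ht).symm i', ?_⟩
      ext j
      simp only [Finset.mem_filter, Finset.mem_univ, true_and, Finset.mem_singleton]
      constructor
      · intro hj
        apply ht.1
        rw [hj]
        exact ((Equiv.ofBijective t ht).apply_symm_apply i').symm
      · intro hj
        rw [hj]
        exact (Equiv.ofBijective t ht).apply_symm_apply i'
    rw [hcard, mul_one]

/-- Summing over bijections of `Fin n` is summing over permutations. [folklore] -/
theorem sum_ite_bijective {M : Type*} [AddCommMonoid M] (φ : (Fin n → Fin n) → M) :
    (∑ t : Fin n → Fin n, if Function.Bijective t then φ t else 0) =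
      ∑ τ : Equiv.Perm (Fin n), φ τ := by
  classical
  rw [← Finset.sum_filter]
  have hset : (Finset.univ.filter fun t : Fin n → Fin n => Function.Bijective t) =
      Finset.univ.map ⟨fun τ : Equiv.Perm (Fin n) => (⇑τ : Fin n → Fin n), DFunLike.coe_injective⟩ := by
    ext t
    simp only [Finset.mem_filter, Finset.mem_univ, true_and, Finset.mem_map,
      Function.Embedding.coeFn_mk]
    constructor
    · intro ht
      exact ⟨Equiv.ofBijective t ht, rfl⟩
    · rintro ⟨τ, rfl⟩
      exact τ.bijective
  rw [hset, Finset.sum_map]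
  rfl

/-- Placing the columns `α_j` in columns `τ j` for a permutation `τ` is permuting the columns of the
exponent with columns `α_j`. [folklore] -/
theorem sum_mapDomain_col_perm (α : Fin n → (Fin n →₀ ℕ)) (τ : Equiv.Perm (Fin n)) :
    ∑ j : Fin n, Finsupp.mapDomain (fun r : Fin n => (r, τ j)) (α j) =
      Finsupp.mapDomain (Prod.map id ⇑τ) (∑ j : Fin n, Finsupp.mapDomain (fun r : Fin n => (r, j)) (α j)) := by
  rw [Finsupp.mapDomain_finsetSum]
  refine Finset.sum_congr rfl fun j _ => ?_
  rw [← Finsupp.mapDomain_comp]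
  rfl

/-- A product of monomials over `Fin n` is the monomial of the summed exponents with the product
coefficient. [folklore] -/
theorem prod_monomial_eq {σ : Type*} (E : Fin n → σ →₀ ℕ) (c : Fin n → k) :
    ∏ j : Fin n, (monomial (E j) (c j) : MvPolynomial σ k) = monomial (∑ j, E j) (∏ j, c j) := by
  have h : ∀ j : Fin n, (monomial (E j) (c j) : MvPolynomial σ k) = C (c j) * monomial (E j) 1 := fun j => by
    rw [C_mul_monomial, mul_one]
  simp only [h]
  rw [Finset.prod_mul_distrib, ← map_prod, ← monomial_sum_one, C_mul_monomial, mul_one]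

/-- **The transfer of a product of column coordinates** (`δ > 0`): for coordinates `X_{α_0}, …,
X_{α_{n-1}}` of `Sym^δ k^n`,
`T(∏_j X_{α_j}) = (∏_j multinomial(α_j)) · ∑_{τ ∈ S_n} τ · ∏_j x_{·,j}^{α_j}` — expanding
`∏_j (∑_i multinomial(α_j) x_{·,i}^{α_j})` over maps `t : forms → forms`, exactly the bijective `t`
give balanced terms. [folklore] -/
theorem transfer_prod_X {δ : ℕ} (hδ : 0 < δ) (α : Fin n → DegIdx (Fin n) δ) :
    weightedHomogeneousComponent (colWeight n) (fun _ : Fin n => δ)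
        (genericOrbitMap (∑ i : Fin n, (X i : MvPolynomial (Fin n) k) ^ δ) δ (∏ j : Fin n, X (α j))) =
      ((∏ j : Fin n, (α j).1.multinomial : ℕ) : k) •
        symmetrize n (monomial (∑ j : Fin n, Finsupp.mapDomain (fun r : Fin n => (r, j)) (α j).1) (1 : k)) := by
  classical
  have hα : ∀ j, (α j).1.degree = δ := fun j => mem_degMonomials_iff.mp (α j).2
  rw [map_prod]
  have hX : ∀ j : Fin n,
      genericOrbitMap (∑ i : Fin n, (X i : MvPolynomial (Fin n) k) ^ δ) δ (X (α j)) =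
        ∑ i : Fin n, monomial (Finsupp.mapDomain (fun r : Fin n => (r, i)) (α j).1)
          (((α j).1.multinomial : ℕ) : k) := fun j => by
    rw [genericOrbitMap_powerSum_X]
    exact Finset.sum_congr rfl fun i _ => coeff_genericLinForm_pow i _ (hα j)
  simp only [hX]
  rw [Finset.prod_univ_sum]
  simp only [Fintype.piFinset_univ, prod_monomial_eq, map_sum]
  have hcomp : ∀ t : Fin n → Fin n,
      weightedHomogeneousComponent (colWeight n) (fun _ : Fin n => δ)
        (monomial (∑ j, Finsupp.mapDomain (fun r : Fin n => (r, t j)) (α j).1)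
          (∏ j, (((α j).1.multinomial : ℕ) : k)) : MvPolynomial (Fin n × Fin n) k) =
      if Function.Bijective t then
        monomial (∑ j, Finsupp.mapDomain (fun r : Fin n => (r, t j)) (α j).1)
          (∏ j, (((α j).1.multinomial : ℕ) : k)) else 0 := by
    intro t
    rw [weightedHomogeneousComponent_of_mem (isWeightedHomogeneous_monomial (colWeight n) _ _ rfl)]
    by_cases ht : Function.Bijective t
    · rw [if_pos ht, if_pos ((weight_sum_mapDomain_col_eq_iff hδ _ hα t).mpr ht).symm]
    · rw [if_neg ht, if_neg fun h => ht ((weight_sum_mapDomain_col_eq_iff hδ _ hα t).mp h.symm)]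
  simp only [hcomp]
  rw [sum_ite_bijective, symmetrize, Finset.smul_sum, Nat.cast_prod]
  refine Finset.sum_congr rfl fun τ _ => ?_
  rw [sum_mapDomain_col_perm, rename_monomial, smul_monomial, smul_eq_mul, mul_one]

/-! ### `𝒪(V^n // H_n)_δ` lies in the image of the degree-`n` forms under the transfer map -/

/-- Multinomial coefficients are nonzero in characteristic zero. [folklore] -/
theorem cast_multinomial_ne_zero [CharZero k] (α : Fin n →₀ ℕ) : ((α.multinomial : ℕ) : k) ≠ 0 := by
  rw [Nat.cast_ne_zero, Finsupp.multinomial_eq]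
  exact (Nat.multinomial_pos _ _).ne'

/-- The symmetrisation of a monomial with columns `α_j` of degree `δ > 0` is the transfer of a form
of degree `n` (characteristic zero). [folklore] -/
theorem symmetrize_monomial_mem_map [CharZero k] {δ : ℕ} (hδ : 0 < δ) (α : Fin n → DegIdx (Fin n) δ) :
    symmetrize n (monomial (∑ j : Fin n, Finsupp.mapDomain (fun r : Fin n => (r, j)) (α j).1) (1 : k)) ∈
      (homogeneousSubmodule (DegIdx (Fin n) δ) k n).map
        ((weightedHomogeneousComponent (colWeight n) (fun _ : Fin n => δ)).comp
          (genericOrbitMap (∑ i : Fin n, (X i : MvPolynomial (Fin n) k) ^ δ) δ).toLinearMap) := by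
  set c : k := ((∏ j : Fin n, (α j).1.multinomial : ℕ) : k) with hc
  have hc0 : c ≠ 0 := by
    rw [hc, Nat.cast_prod]
    exact Finset.prod_ne_zero_iff.mpr fun j _ => cast_multinomial_ne_zero _
  have hPhom : (∏ j : Fin n, X (α j) : MvPolynomial (DegIdx (Fin n) δ) k).IsHomogeneous n := by
    have h := IsHomogeneous.prod Finset.univ
      (fun j : Fin n => (X (α j) : MvPolynomial (DegIdx (Fin n) δ) k)) (fun _ => 1)
      fun j _ => isHomogeneous_X k _
    simpa using h
  refine ⟨c⁻¹ • ∏ j : Fin n, X (α j), Submodule.smul_mem _ _ ((mem_homogeneousSubmodule n _).mpr hPhom), ?_⟩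
  rw [map_smul, LinearMap.comp_apply, AlgHom.toLinearMap_apply, transfer_prod_X hδ α, ← hc, smul_smul,
    inv_mul_cancel₀ hc0, one_smul]

/-- An exponent of `k[Mat_n]` is the sum of its columns placed in their columns. [folklore] -/
theorem eq_sum_mapDomain_col (s : Fin n × Fin n →₀ ℕ) :
    s = ∑ j : Fin n, Finsupp.mapDomain (fun r : Fin n => (r, j))
      (Finsupp.equivFunOnFinite.symm fun i => s (i, j)) := by
  classical
  ext ⟨r, i'⟩
  rw [Finsupp.coe_finsetSum, Finset.sum_apply]
  simp only [mapDomain_col_apply, Finsupp.coe_equivFunOnFinite_symm]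
  rw [Finset.sum_ite_eq Finset.univ i' (fun j => s (r, j)), if_pos (Finset.mem_univ _)]

/-- **`𝒪(V^n // H_n)_δ = Sym^n Sym^δ V^*` lies in the image of `k[Sym^δ k^n]_n` under the transfer
map** (`δ > 0`, characteristic zero): a balanced form-symmetric `G` is `(n!)⁻¹ ∑_s G_s · ∑_τ τ · x^s`,
and each `∑_τ τ · x^s` is a transfer (`symmetrize_monomial_mem_map`, the columns of `s` having
degree `δ`). [folklore] -/
theorem symBalanced_le_map [CharZero k] {δ : ℕ} (hδ : 0 < δ) :
    symBalanced (k := k) n δ ≤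
      (homogeneousSubmodule (DegIdx (Fin n) δ) k n).map
        ((weightedHomogeneousComponent (colWeight n) (fun _ : Fin n => δ)).comp
          (genericOrbitMap (∑ i : Fin n, (X i : MvPolynomial (Fin n) k) ^ δ) δ).toLinearMap) := by
  classical
  intro G hG
  have hsymm : symmetrize n G = (Fintype.card (Equiv.Perm (Fin n)) : k) • G := hG.2.symmetrize_eq
  have hcard : (Fintype.card (Equiv.Perm (Fin n)) : k) ≠ 0 := Nat.cast_ne_zero.mpr Fintype.card_ne_zero
  have hG' : G = (Fintype.card (Equiv.Perm (Fin n)) : k)⁻¹ • symmetrize n G := by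
    rw [hsymm, smul_smul, inv_mul_cancel₀ hcard, one_smul]
  rw [hG', as_sum G, symmetrize_sum]
  refine Submodule.smul_mem _ _ (Submodule.sum_mem _ fun s hs => ?_)
  have hmon : (monomial s (coeff s G) : MvPolynomial (Fin n × Fin n) k) = coeff s G • monomial s 1 := by
    rw [smul_monomial, smul_eq_mul, mul_one]
  rw [hmon, symmetrize_smul]
  refine Submodule.smul_mem _ _ ?_
  have hdeg : ∀ j : Fin n, (Finsupp.equivFunOnFinite.symm fun i => s (i, j) : Fin n →₀ ℕ).degree = δ := by
    intro j
    rw [Finsupp.degree_eq_sum]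
    simp only [Finsupp.coe_equivFunOnFinite_symm]
    exact (isBalanced_iff n δ G).mp hG.1 s hs j
  have h := symmetrize_monomial_mem_map (k := k) hδ fun j => ⟨_, mem_degMonomials_iff.mpr (hdeg j)⟩
  rwa [← eq_sum_mapDomain_col s] at h

/-! ### Lifting highest-weight vectors through the transfer map -/

/-- **Realised weights occur in `k[Sym^δ k^n]_n`** (characteristic zero, `δ > 0`): a nonzero
highest-weight vector of weight `ψ` of `formsRep` in `𝒪(V^n // H_n)_δ = Sym^n Sym^δ V^*`
(`IsRealized k n δ ψ`) lifts through the transfer map to a nonzero highest-weight vector of weight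
`ψ` of `coordRep` among the forms of degree `n` on `Sym^δ k^n` (`k[Sym^δ k^n]_n = Sym^n (Sym^δ V)^*`;
complete reducibility of the degree-`n` piece, `map_highestWeightSpace_eq_of_surjective`). This is
the dictionary between BHI's Lemma 4 ("`V_G(λ)` occurs in `Sym^n Sym^{|λ|/n} ℂ^n`", read in
`𝒪(V^n // H_n)`) and the tree's `symSymOcc`. [cite: BurgisserHuttenhainIkenmeyer2017, Lemma 4] -/
theorem exists_mem_highestWeightSpace_coordRep_of_isRealized [CharZero k] {δ : ℕ} (hδ : 0 < δ)
    {ψ : Weight (Fin n)} (h : IsRealized k n δ ψ) :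
    ∃ F : MvPolynomial (DegIdx (Fin n) δ) k,
      F ≠ 0 ∧ F.IsHomogeneous n ∧ F ∈ highestWeightSpace (coordRep (Fin n) k δ) ψ := by
  obtain ⟨G, hG0, hGb, hGw⟩ := h
  -- the degree-`n` piece as a subrepresentation and the transfer map on it as an intertwining map
  let W : Subrepresentation (coordRep (Fin n) k δ) :=
    { toSubmodule := homogeneousSubmodule (DegIdx (Fin n) δ) k n
      apply_mem_toSubmodule := fun g _ hF =>
        (mem_homogeneousSubmodule n _).mpr (isHomogeneous_coordSubst g ((mem_homogeneousSubmodule n _).mp hF)) }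
  let T : MvPolynomial (DegIdx (Fin n) δ) k →ₗ[k] MvPolynomial (Fin n × Fin n) k :=
    (weightedHomogeneousComponent (colWeight n) (fun _ : Fin n => δ)).comp
      (genericOrbitMap (∑ i : Fin n, (X i : MvPolynomial (Fin n) k) ^ δ) δ).toLinearMap
  let π : W.toRepresentation.IntertwiningMap (formsRep (k := k) n) :=
    { toLinearMap := T.comp W.toSubmodule.subtype
      isIntertwining' := fun g => LinearMap.ext fun F => transfer_coordSubst g F.1 }
  have hπ : ∀ F : W.toSubmodule, π F = T F.1 := fun F => rfl
  have hsurj := intertwiningRangeRestrict_surjective π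
  have hss : W.toRepresentation.IsSemisimpleRepresentation :=
    isSemisimpleRepresentation_toRepresentation _ (isSemisimpleRepresentation_coordRep δ)
  have hmap := map_highestWeightSpace_eq_of_surjective _ hsurj hss ψ
  have hGmem : G ∈ π.range.toSubmodule := by
    obtain ⟨P, hP, hPG⟩ := Submodule.mem_map.mp (symBalanced_le_map hδ hGb)
    exact ⟨⟨P, hP⟩, hPG⟩
  have hGhw : (⟨G, hGmem⟩ : ↥π.range.toSubmodule) ∈ highestWeightSpace π.range.toRepresentation ψ := by
    intro b hb
    apply Subtype.ext
    exact hGw b hb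
  rw [← hmap] at hGhw
  obtain ⟨F, hF, hFG⟩ := Submodule.mem_map.mp hGhw
  have hFG' : T F.1 = G := by rw [← hπ]; exact congrArg Subtype.val hFG
  refine ⟨F.1, fun h0 => hG0 ?_, (mem_homogeneousSubmodule n F.1).mp F.2, fun b hb => ?_⟩
  · rw [← hFG', h0, map_zero]
  · exact congrArg Subtype.val (hF b hb)

/-- **A weight pins the degree**, converse form: a nonzero highest-weight vector of `k[Sym^δ k^n]`
of weight `ψ` which is a form of degree `D` has `|ψ| = -δ D` (its monomials have torus weight `ψ`,
`monWeight_eq_of_mem_weightSpace`). [cite: BurgisserEtAl2011, §4.4] -/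
theorem size_eq_of_mem_highestWeightSpace_coordRep [Infinite k] {δ D : ℕ} {ψ : Weight (Fin n)}
    {F : MvPolynomial (DegIdx (Fin n) δ) k} (hF0 : F ≠ 0) (hFh : F.IsHomogeneous D)
    (hFw : F ∈ highestWeightSpace (coordRep (Fin n) k δ) ψ) :
    ψ.size = -((δ * D : ℕ) : ℤ) := by
  classical
  obtain ⟨s, hs⟩ := support_nonempty.mpr hF0
  have hw := monWeight_eq_of_mem_weightSpace (highestWeightSpace_le_weightSpace _ _ hFw) hs
  have hdeg : s.degree = D := by
    rw [Finsupp.degree_eq_weight_one]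
    exact hFh (mem_support_iff.mp hs)
  rw [← hw, size_monWeight, hdeg]

/-- **Highest weights of `k[Sym^e k^n]` are duals of polynomial weights** (over an infinite field):
a nonzero highest-weight vector `F` does not vanish at some form `f`, hence is a highest-weight
vector of the coordinate ring of the orbit closure of `f`, whose weights are dominant and
nonpositive (`isDominant_of_hasHighestWeight_orbitCoordRep`,
`nonpos_and_exists_size_eq_of_hasHighestWeight_orbitCoordRep`). [cite: BurgisserEtAl2011, §4.4 and (5.2.2)] -/
theorem isPolynomial_dual_of_hasHighestWeight_coordRep [Infinite k] {e : ℕ} {μ : Weight (Fin n)}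
    (h : HasHighestWeight (coordRep (Fin n) k e) μ) : μ.dual.IsPolynomial := by
  classical
  obtain ⟨F, hF0, hFw⟩ := (hasHighestWeight_iff_exists _ _).mp h
  -- a point where `F` does not vanish
  have hpt : ∃ p : DegIdx (Fin n) e → k, eval p F ≠ 0 := by
    by_contra hall
    push Not at hall
    exact hF0 (MvPolynomial.funext fun p => by rw [hall p, map_zero])
  obtain ⟨p, hp⟩ := hpt
  -- the form with coefficient vector `p`
  set f : MvPolynomial (Fin n) k := ∑ d : DegIdx (Fin n) e, p d • monomial d.1 1 with hf
  have hcoeff : formCoeff e f = p := by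
    funext d
    rw [formCoeff_apply, hf, coeff_sum]
    simp only [coeff_smul, coeff_monomial, smul_eq_mul, mul_ite, mul_one, mul_zero]
    rw [Finset.sum_eq_single d (fun d' _ hd' => if_neg fun h => hd' (Subtype.ext h))
      (fun h => absurd (Finset.mem_univ d) h), if_pos rfl]
  have hnot : F ∉ orbitVanishingIdeal f e := by
    intro hmem
    have h1 := mem_orbitVanishingIdeal_iff.mp hmem 1
    rw [map_one, Module.End.one_apply, hcoeff] at h1
    exact hp h1
  have hocc := hasHighestWeight_orbitCoordRep_of_not_mem f e hFw hnot
  have hdom : μ.IsDominant := isDominant_of_hasHighestWeight_orbitCoordRep _ hocc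
  have hnonpos := (nonpos_and_exists_size_eq_of_hasHighestWeight_orbitCoordRep _ hocc).1
  refine ⟨(Weight.isDominant_dual_iff_holds μ.dual).mp (by rwa [Weight.dual_dual]), fun i => ?_⟩
  simp only [Weight.dual, Left.nonneg_neg_iff]
  exact hnonpos _

/-- The zero weight occurs in every `k[Sym^e k^n]` (the constant `1`). [folklore] -/
theorem hasHighestWeight_coordRep_zero (n e : ℕ) :
    HasHighestWeight (coordRep (Fin n) k e) 0 := by
  rw [hasHighestWeight_iff_exists]
  refine ⟨1, one_ne_zero, fun g _ => ?_⟩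
  rw [coordRep_apply, map_one, weightChar, Finset.prod_eq_one fun i _ => by rw [Pi.zero_apply, zpow_zero],
    one_smul]

/-! ### The two directions of BHI Prop. 1 (cone part) for the Chow variety -/

/-- The zero weight lies in `S(V^n // H_n)`. [folklore] -/
theorem zero_mem_normChowWeights (n : ℕ) : (0 : Weight (Fin n)) ∈ normChowWeights n := by
  refine ⟨by simp [Weight.size], ?_⟩
  rw [mem_symSymOcc_iff, Weight.dual_zero]
  exact hasHighestWeight_coordRep_zero _ _

/-- **Realised weights lie in `S(V^n // H_n)`** in the tree's rendering: if `ψ` is realised in a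
positive degree `δ` then `ψ^* ∈ normChowWeights n`, i.e. `V(ψ^*)` occurs in
`Sym^n Sym^δ ℂ^n` with `|ψ^*| = n δ` (BHI Lemma 4, through the transfer map).
[cite: BurgisserHuttenhainIkenmeyer2017, Lemma 4] -/
theorem dual_mem_normChowWeights_of_isRealized (hn : 0 < n) {δ : ℕ} (hδ : 0 < δ)
    {ψ : Weight (Fin n)} (h : IsRealized ℂ n δ ψ) : ψ.dual ∈ normChowWeights n := by
  obtain ⟨F, hF0, hFh, hFw⟩ := exists_mem_highestWeightSpace_coordRep_of_isRealized hδ h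
  refine mem_normChowWeights_of_size hn (k := δ) ?_ ?_
  · rw [mem_symSymOcc_iff, Weight.dual_dual, hasHighestWeight_iff_exists]
    exact ⟨F, hF0, hFw⟩
  · rw [Weight.size_dual, size_eq_of_mem_highestWeightSpace_coordRep hF0 hFh hFw, neg_neg, Nat.mul_comm]

/-- **`C_ℚ(S(Chow_n)) ⊆ C_ℚ(S(V^n // H_n))`**: a weight with a positive multiple in `S(Chow_n)` is
polynomial, and `2n · χ` is realised in `𝒪(V^n // H_n)` by the cone generators
(`isRealized_conePsi`), hence lies in `normChowWeights n`. [cite: BurgisserHuttenhainIkenmeyer2017, Prop. 1 with Lemmas 3–4 (proof of Prop. 2)] -/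
theorem exists_nsmul_mem_normChowWeights_of_mem_ratCone (hn : 0 < n) {χ : Weight (Fin n)}
    (h : χ ∈ ratCone (chowOccWeights n)) : ∃ K : ℕ, 0 < K ∧ K • χ ∈ normChowWeights n := by
  obtain ⟨k₀, hk₀, hmem⟩ := h
  have hpoly : χ.IsPolynomial := (isPolynomial_of_mem_chowOccWeights hmem).of_nsmul hk₀
  by_cases h0 : χ = 0
  · refine ⟨1, Nat.one_pos, ?_⟩
    rw [h0, smul_zero]
    exact zero_mem_normChowWeights n
  · haveI : NeZero n := ⟨hn.ne'⟩
    refine ⟨2 * n, by omega, ?_⟩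
    rw [← dual_conePsi n hpoly]
    exact dual_mem_normChowWeights_of_isRealized hn (coneDeg_pos n hpoly h0) (isRealized_conePsi ℂ n χ)

/-- **`C_ℚ(S(V^n // H_n)) ⊆ C_ℚ(S(Chow_n))`**: a weight with a positive multiple in
`normChowWeights n` is polynomial (`isPolynomial_dual_of_hasHighestWeight_coordRep`), hence has a
positive multiple in `S(Chow_n)` (`exists_nsmul_mem_chowOccWeights`: the cone realisation pushed
into `𝒪(Chow_n)` by Brion's theorem). [cite: BurgisserHuttenhainIkenmeyer2017, Prop. 1 with Lemmas 3–4 (proof of Prop. 2)] -/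
theorem mem_ratCone_of_nsmul_mem_normChowWeights (hn : 0 < n) {χ : Weight (Fin n)} {K : ℕ}
    (hK : 0 < K) (h : K • χ ∈ normChowWeights n) : χ ∈ ratCone (chowOccWeights n) := by
  obtain ⟨-, hocc⟩ := h
  rw [mem_symSymOcc_iff] at hocc
  have hpoly : (K • χ).IsPolynomial := by
    have := isPolynomial_dual_of_hasHighestWeight_coordRep hocc
    rwa [Weight.dual_dual] at this
  exact exists_nsmul_mem_chowOccWeights hn (hpoly.of_nsmul hK)

/-- **BHI Prop. 1 (cone part) for the Chow variety — discharge of the named fact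
`BHI2017_prop1_cone`**: "the semigroups `S(Chow_n)` and `S(V^n // H_n)` generate the same rational
cone", with `S(V^n // H_n)` in its Lemma-4 description `normChowWeights n`. In print Prop. 1 is
derived from the minimal polynomial of an integral highest-weight vector over `𝒪(Z)`; here both
cones are identified with the cone of all polynomial weights: `⊆` by the cone generators realised in
`𝒪(V^n // H_n)` (`isRealized_conePsi`) transferred to `k[Sym^δ k^n]_n`
(`exists_mem_highestWeightSpace_coordRep_of_isRealized`), `⊇` by Brion's theorem
(`exists_nsmul_mem_chowOccWeights`). [cite: BurgisserHuttenhainIkenmeyer2017, Prop. 1 with Lemmas 3–4 (proof of Prop. 2)] -/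
theorem BHI2017_prop1_cone_holds : BHI2017_prop1_cone := fun _ hn _ =>
  ⟨exists_nsmul_mem_normChowWeights_of_mem_ratCone hn,
    fun ⟨_, hK, h⟩ => mem_ratCone_of_nsmul_mem_normChowWeights hn hK h⟩

end Literature.Barriers.ValiantsHypothesis
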